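import Mathlib
import Summits.MatrixMultiplication.Statement
import Summits.MatrixMultiplication.MatrixMultiplication.Theorems.GraphEquationsPointwisePurification
import Summits.MatrixMultiplication.MatrixMultiplication.Theorems.GraphEquationsIsotropicJoin

/-!
# Graph equations — the ISOTROPIC KERNEL LEMMA and `CubicEquationsForceMultiplication` (M66)

This file closes the chain M57–M65:

* `exists_polyKernel` — CRAMER KERNEL FIELD: if every `x` (including `x = 0`, `d > 0`) has a
  nonzero `y` with `xᵀ Mᵢ y = 0 ∀ i`, then all `d`-minors of the polynomial matrix
  `T(x) = (Σ_j x_j M_{i,j,k})_{i,k}` vanish identically; taking a non-vanishing minor of MAXIMAL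
  size `r < d` and bordering it by one new column and a variable row, the vector of cofactors along
  the variable row is a NONZERO polynomial vector `F` with `T(x) F(x) ≡ 0` (its entries against any
  row of `T` are `(r+1)`-minors).
* `exists_isotropic_coord` — with the ruled-join theorem (M65) this gives an isotropic `x ≠ 0`.
* **`isotropicKernelLemma_all : ∀ d, IsotropicKernelLemma d`** (transfer to abstract spaces by a
  basis), hence, by M64,
* **`AffSystem.Correct.exists_line_reduced`** — every correct affine system is purified at EVERY
  base point by two horizontal rounds along some line; **`depthBound_one`**, **`horizontalUnmask_one`**;
* **`cubicEquationsForceMultiplication : CubicEquationsForceMultiplication`** — `[ω₃ = ω]`: cheap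
  correct CUBIC equation systems for the graph of `n × n` matrix multiplication force cheap
  multiplication.  Consequently the crux `MultiplicityReduction` of the route is now EQUIVALENT to
  its degree-reduction half `CubicDegreeReduction` (`multiplicityReduction_iff_cubicDegreeReduction`),
  and `ω = 2 ↔ GraphEquationsQuadratic ∧ CubicDegreeReduction`
  (`matrixMultiplication_iff_quadratic_and_cdr`).
-/

set_option linter.dupNamespace false

namespace Summit.MatrixMultiplication.MatrixMultiplication.Theorems.GraphEquations

open MvPolynomial Matrix

section Cramer

variable {d m : ℕ}

/-- `xᵀ N y` as a double sum. -/
theorem dotProduct_mulVec_eq_sum₂ (N : Matrix (Fin d) (Fin d) ℂ) (x y : Fin d → ℂ) :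
    x ⬝ᵥ (N *ᵥ y) = ∑ j, ∑ k, x j * N j k * y k := by
  simp only [dotProduct, mulVec, Finset.mul_sum, mul_assoc]

/-- The polynomial matrix `T(x)`, `T_{i,k}(x) = Σ_j x_j M_{i,j,k}`, so that `T(x) y = (xᵀ Mᵢ y)ᵢ`. -/
noncomputable def bilinMatrix (M : Fin m → Matrix (Fin d) (Fin d) ℂ) :
    Matrix (Fin m) (Fin d) (MvPolynomial (Fin d) ℂ) :=
  Matrix.of fun i k => bilinRowPoly M i k

/-- `T(x) y = (xᵀ Mᵢ y)ᵢ`. -/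
theorem bilinMatrix_eval_mulVec (M : Fin m → Matrix (Fin d) (Fin d) ℂ) (x y : Fin d → ℂ)
    (i : Fin m) : (((bilinMatrix M).map (eval x)) *ᵥ y) i = x ⬝ᵥ (M i *ᵥ y) := by
  rw [dotProduct_mulVec_eq_sum]
  simp [bilinMatrix, mulVec, dotProduct, eval_bilinRowPoly]

/-- Under the hypothesis of the isotropic kernel lemma, `T(x)` has a nonzero kernel vector at EVERY
point `x` (at `x = 0` trivially, as `d > 0`). -/
theorem exists_kernel_eval (M : Fin m → Matrix (Fin d) (Fin d) ℂ) (hd : 0 < d)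
    (hyp : ∀ x : Fin d → ℂ, x ≠ 0 → ∃ y : Fin d → ℂ, y ≠ 0 ∧ ∀ i, x ⬝ᵥ (M i *ᵥ y) = 0)
    (x : Fin d → ℂ) : ∃ y : Fin d → ℂ, y ≠ 0 ∧ ((bilinMatrix M).map (eval x)) *ᵥ y = 0 := by
  by_cases hx : x = 0
  · refine ⟨fun _ => 1, fun h => one_ne_zero (congr_fun h ⟨0, hd⟩), funext fun i => ?_⟩
    rw [Pi.zero_apply, bilinMatrix_eval_mulVec, hx, zero_dotProduct]
  · obtain ⟨y, hy, h⟩ := hyp x hx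
    exact ⟨y, hy, funext fun i => by rw [Pi.zero_apply, bilinMatrix_eval_mulVec]; exact h i⟩

/-- All `d`-minors of `T(x)` vanish identically. -/
theorem det_submatrix_bilinMatrix_eq_zero (M : Fin m → Matrix (Fin d) (Fin d) ℂ) (hd : 0 < d)
    (hyp : ∀ x : Fin d → ℂ, x ≠ 0 → ∃ y : Fin d → ℂ, y ≠ 0 ∧ ∀ i, x ⬝ᵥ (M i *ᵥ y) = 0)
    (ρ : Fin d → Fin m) (γ : Fin d → Fin d) : ((bilinMatrix M).submatrix ρ γ).det = 0 := by
  classical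
  apply MvPolynomial.funext
  intro x
  rw [map_zero, RingHom.map_det, RingHom.mapMatrix_apply]
  rw [show ((bilinMatrix M).submatrix ρ γ).map (eval x) =
    ((bilinMatrix M).map (eval x)).submatrix ρ γ from rfl]
  set Tx := (bilinMatrix M).map (eval x)
  obtain ⟨y, hy, hTy⟩ := exists_kernel_eval M hd hyp x
  by_cases hγ : Function.Injective γ
  · have hbij : Function.Bijective γ := Finite.injective_iff_bijective.1 hγ
    let e : Fin d ≃ Fin d := Equiv.ofBijective γ hbij
    refine Matrix.exists_mulVec_eq_zero_iff.1 ⟨fun b => y (γ b), ?_, ?_⟩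
    · intro h
      apply hy
      funext k
      obtain ⟨b, rfl⟩ := hbij.2 k
      simpa using congr_fun h b
    · funext a
      have h1 := congr_fun hTy (ρ a)
      rw [Pi.zero_apply] at h1 ⊢
      rw [← h1]
      simp only [mulVec, dotProduct, submatrix_apply]
      exact e.sum_comp (fun k => Tx (ρ a) k * y k)
  · obtain ⟨a, b, hab, hne⟩ := Function.not_injective_iff.1 hγ
    exact Matrix.det_zero_of_column_eq hne fun k => by simp [hab]

set_option maxHeartbeats 800000 in
/-- **Cramer kernel field.**  Under the hypothesis of the isotropic kernel lemma (`d > 0`) there is a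
NONZERO polynomial vector `F` with `T(x) F(x) ≡ 0`: the cofactors along a variable row bordering a
non-vanishing minor of maximal size. -/
theorem exists_polyKernel (M : Fin m → Matrix (Fin d) (Fin d) ℂ) (hd : 0 < d)
    (hyp : ∀ x : Fin d → ℂ, x ≠ 0 → ∃ y : Fin d → ℂ, y ≠ 0 ∧ ∀ i, x ⬝ᵥ (M i *ᵥ y) = 0) :
    ∃ (F : Fin d → MvPolynomial (Fin d) ℂ) (q₀ : Fin d),
      F q₀ ≠ 0 ∧ ∀ i, ∑ k, bilinRowPoly M i k * F k = 0 := by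
  classical
  set T := bilinMatrix M with hT
  let P : ℕ → Prop := fun s =>
    ∃ (ρ : Fin s → Fin m) (γ : Fin s → Fin d), (T.submatrix ρ γ).det ≠ 0
  have hP0 : P 0 := ⟨Fin.elim0, Fin.elim0, by simp [Matrix.det_isEmpty]⟩
  have hPd : ¬ P d := fun ⟨ρ, γ, h⟩ => h (det_submatrix_bilinMatrix_eq_zero M hd hyp ρ γ)
  obtain ⟨r, hr⟩ : ∃ r, r = Nat.findGreatest P d := ⟨_, rfl⟩
  have hPr : P r := hr ▸ Nat.findGreatest_spec (Nat.zero_le d) hP0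
  have hrle : r ≤ d := hr ▸ Nat.findGreatest_le d
  have hrd : r < d := lt_of_le_of_ne hrle fun h => hPd (h ▸ hPr)
  have hPr1 : ¬ P (r + 1) :=
    Nat.findGreatest_is_greatest (hr ▸ Nat.lt_succ_self r) (Nat.succ_le_of_lt hrd)
  obtain ⟨ρ₀, γ₀, hμ⟩ := hPr
  -- a new column
  obtain ⟨k₀, hk₀⟩ : ∃ k₀ : Fin d, ∀ a, γ₀ a ≠ k₀ := by
    by_contra h
    have hs : Function.Surjective γ₀ := fun k => by
      by_contra hk
      exact h ⟨k, fun a hak => hk ⟨a, hak⟩⟩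
    have := Fintype.card_le_of_surjective γ₀ hs
    simp only [Fintype.card_fin] at this
    omega
  -- the bordered block with a variable last row
  let γ : Fin (r + 1) → Fin d := Fin.snoc γ₀ k₀
  let rows : Fin r → (Fin (r + 1) → MvPolynomial (Fin d) ℂ) := fun a b => T (ρ₀ a) (γ b)
  let N : (Fin (r + 1) → MvPolynomial (Fin d) ℂ) →
      Matrix (Fin (r + 1)) (Fin (r + 1)) (MvPolynomial (Fin d) ℂ) :=
    fun w => Matrix.of (Fin.snoc rows w)
  have hN_last : ∀ w b, N w (Fin.last r) b = w b := fun w b => by simp [N]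
  have hN_cast : ∀ w a b, N w (Fin.castSucc a) b = T (ρ₀ a) (γ b) := fun w a b => by
    simp [N, rows]
  have hN_upd : ∀ w v, (N w).updateRow (Fin.last r) v = N v := by
    intro w v
    ext a b
    by_cases ha : a = Fin.last r
    · subst ha
      rw [updateRow_self, hN_last]
    · rw [updateRow_ne ha]
      obtain ⟨a', rfl⟩ := Fin.exists_castSucc_eq.2 ha
      rw [hN_cast, hN_cast]
  -- cofactors along the last row
  let c : Fin (r + 1) → MvPolynomial (Fin d) ℂ := fun b => (N (Pi.single b 1)).det
  have hexp : ∀ w, ∑ b, w b * c b = (N w).det := by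
    intro w
    have h := congr_fun (congr_fun (Matrix.mul_adjugate (N w)) (Fin.last r)) (Fin.last r)
    rw [Matrix.mul_apply, Matrix.smul_apply, Matrix.one_apply_eq, smul_eq_mul, mul_one] at h
    rw [← h]
    refine Finset.sum_congr rfl fun b _ => ?_
    rw [hN_last, adjugate_apply, hN_upd]
  -- `(r+1)`-minors vanish: every row of `T` is orthogonal to `c` on the columns `γ`
  have hrow : ∀ i, ∑ b, T i (γ b) * c b = 0 := by
    intro i
    rw [hexp]
    have hNi : N (fun b => T i (γ b)) = T.submatrix (Fin.snoc ρ₀ i) γ := by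
      ext a b
      by_cases ha : a = Fin.last r
      · subst ha
        rw [hN_last, submatrix_apply, Fin.snoc_last]
      · obtain ⟨a', rfl⟩ := Fin.exists_castSucc_eq.2 ha
        rw [hN_cast, submatrix_apply, Fin.snoc_castSucc]
    rw [hNi]
    by_contra h
    exact hPr1 ⟨Fin.snoc ρ₀ i, γ, h⟩
  -- the last cofactor is the chosen non-vanishing `r`-minor
  have hclast : c (Fin.last r) = (T.submatrix ρ₀ γ₀).det := by
    show (N (Pi.single (Fin.last r) 1)).det = _
    rw [Matrix.det_succ_row _ (Fin.last r), Finset.sum_eq_single (Fin.last r)]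
    · have hsub : (N (Pi.single (Fin.last r) 1)).submatrix (Fin.last r).succAbove
          (Fin.last r).succAbove = T.submatrix ρ₀ γ₀ := by
        ext a b
        rw [submatrix_apply, submatrix_apply, Fin.succAbove_last, hN_cast]
        simp [γ]
      rw [hN_last, Pi.single_eq_same, mul_one, hsub, Fin.val_last, Even.neg_one_pow ⟨r, rfl⟩,
        one_mul]
    · intro b _ hb
      rw [hN_last, Pi.single_eq_of_ne hb, mul_zero, zero_mul]
    · intro h
      exact absurd (Finset.mem_univ _) h
  -- the kernel field, extended by zero outside the columns `γ`
  let F : Fin d → MvPolynomial (Fin d) ℂ := fun k => ∑ b, if γ b = k then c b else 0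
  have hTF : ∀ i, ∑ k, bilinRowPoly M i k * F k = 0 := by
    intro i
    have hTi : ∀ k, bilinRowPoly M i k = T i k := fun k => rfl
    calc ∑ k, bilinRowPoly M i k * F k
        = ∑ k, ∑ b, (if γ b = k then T i k * c b else 0) := by
          refine Finset.sum_congr rfl fun k _ => ?_
          rw [hTi, Finset.mul_sum]
          refine Finset.sum_congr rfl fun b _ => ?_
          split_ifs <;> simp
      _ = ∑ b, ∑ k, (if γ b = k then T i k * c b else 0) := Finset.sum_comm
      _ = ∑ b, T i (γ b) * c b := by
          refine Finset.sum_congr rfl fun b _ => ?_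
          rw [Finset.sum_ite_eq]
          simp
      _ = 0 := hrow i
  have hFk₀ : F k₀ = c (Fin.last r) := by
    show ∑ b, (if γ b = k₀ then c b else 0) = _
    rw [Finset.sum_eq_single (Fin.last r)]
    · simp [γ, Fin.snoc_last]
    · intro b _ hb
      obtain ⟨a, rfl⟩ := Fin.exists_castSucc_eq.2 hb
      simp [γ, Fin.snoc_castSucc, hk₀ a]
    · intro h
      exact absurd (Finset.mem_univ _) h
  exact ⟨F, k₀, by rw [hFk₀, hclast]; exact hμ, hTF⟩

/-- **The isotropic kernel lemma in coordinates.** -/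
theorem exists_isotropic_coord (M : Fin m → Matrix (Fin d) (Fin d) ℂ) (hd : 0 < d)
    (hyp : ∀ x : Fin d → ℂ, x ≠ 0 → ∃ y : Fin d → ℂ, y ≠ 0 ∧ ∀ i, x ⬝ᵥ (M i *ᵥ y) = 0) :
    ∃ x : Fin d → ℂ, x ≠ 0 ∧ ∀ i, x ⬝ᵥ (M i *ᵥ x) = 0 := by
  obtain ⟨F, q₀, hF, hTF⟩ := exists_polyKernel M hd hyp
  exact exists_isotropic_of_polyKernel M F q₀ hF hTF

end Cramer

/-! ## The isotropic kernel lemma and its consequences -/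

set_option maxHeartbeats 400000 in
/-- **THE ISOTROPIC KERNEL LEMMA** (all dimensions): if `b₁, …, b_m` are bilinear forms on a
nonzero finite-dimensional complex vector space and every `x ≠ 0` is left-orthogonal to some
`y ≠ 0`, then some `x ≠ 0` is isotropic for every `bᵢ`. -/
theorem isotropicKernelLemma_all (d : ℕ) : IsotropicKernelLemma d := by
  intro V _ _ _ _ m b hne hyp
  classical
  let bs := Module.finBasis ℂ V
  let e := bs.equivFun
  let Mx : Fin m → Matrix (Fin (Module.finrank ℂ V)) (Fin (Module.finrank ℂ V)) ℂ :=
    fun i => Matrix.of fun j k => b i (bs j) (bs k)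
  have key : ∀ i (x y : V), b i x y = (e x) ⬝ᵥ (Mx i *ᵥ e y) := by
    intro i x y
    conv_lhs => rw [← bs.sum_equivFun x, ← bs.sum_equivFun y]
    rw [dotProduct_mulVec_eq_sum₂]
    simp only [map_sum, map_smul, LinearMap.sum_apply, LinearMap.smul_apply, smul_eq_mul,
      Finset.mul_sum, Mx, Matrix.of_apply, e]
    rw [Finset.sum_comm]
    refine Finset.sum_congr rfl fun j _ => Finset.sum_congr rfl fun k _ => ?_
    ring
  have hn : 0 < Module.finrank ℂ V := Module.finrank_pos_iff_exists_ne_zero.mpr hne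
  have hypc : ∀ x : Fin (Module.finrank ℂ V) → ℂ, x ≠ 0 →
      ∃ y : Fin (Module.finrank ℂ V) → ℂ, y ≠ 0 ∧ ∀ i, x ⬝ᵥ (Mx i *ᵥ y) = 0 := by
    intro x hx
    obtain ⟨y, hy, hxy⟩ := hyp (e.symm x) (by simpa using hx)
    refine ⟨e y, by simpa using hy, fun i => ?_⟩
    have := hxy i
    rw [key] at this
    simpa using this
  obtain ⟨x, hx, hxx⟩ := exists_isotropic_coord Mx hn hypc
  refine ⟨e.symm x, by simpa using hx, fun i => ?_⟩
  rw [key]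
  simpa using hxx i

namespace AffSystem

variable {n : ℕ} {S : AffSystem n}

/-- **Pointwise purification (unconditional).**  A correct affine system is purified at EVERY base
point by two horizontal rounds along some base line. -/
theorem Correct.exists_line_reduced (hC : S.Correct) (A B : Vec n) :
    ∃ U V : Vec n, (S.happend₂ U V).ReducedAt A B :=
  hC.exists_line_reduced_of_iso_sq (isotropicKernelLemma_all _) A B

end AffSystem

/-- **`DepthBound n 1`** for every `n`: horizontal depth one always suffices. -/
theorem depthBound_one (n : ℕ) : DepthBound n 1 :=
  depthBound_one_of_iso (isotropicKernelLemma_all _)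

/-- **`HorizontalUnmask 1 n`** for every `n`. -/
theorem horizontalUnmask_one (n : ℕ) : HorizontalUnmask 1 n :=
  horizontalUnmask_one_of_iso (isotropicKernelLemma_all _)

/-- **`[ω₃ = ω]` — cheap correct CUBIC equation systems for the graph of matrix multiplication
force cheap matrix multiplication.** -/
theorem cubicEquationsForceMultiplication : CubicEquationsForceMultiplication :=
  cubicEquationsForceMultiplication_of_iso isotropicKernelLemma_all

/-- The crux `MultiplicityReduction` is now equivalent to its degree-reduction half. -/
theorem multiplicityReduction_iff_cubicDegreeReduction :
    MultiplicityReduction ↔ CubicDegreeReduction := by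
  rw [multiplicityReduction_iff_cubic_split]
  exact ⟨fun h => h.2, fun h => ⟨cubicEquationsForceMultiplication, h⟩⟩

/-- `ω = 2 ↔ [ω_v = 2] ∧ CDR`. -/
theorem matrixMultiplication_iff_quadratic_and_cdr :
    _root_.MatrixMultiplication ↔ GraphEquationsQuadratic ∧ CubicDegreeReduction := by
  rw [matrixMultiplication_iff_cubic_split]
  exact ⟨fun h => ⟨h.1, h.2.2⟩, fun h => ⟨h.1, cubicEquationsForceMultiplication, h.2⟩⟩

end Summit.MatrixMultiplication.MatrixMultiplication.Theorems.GraphEquations
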